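import Mathlib
import Summits.MatrixMultiplication.MatrixMultiplication.Theorems.SnSubsetDichotomyPolynomialSlackHubDyadic
import Summits.MatrixMultiplication.MatrixMultiplication.Theorems.SnSubsetDichotomyPolynomialSlackBlockCounts
import Summits.MatrixMultiplication.MatrixMultiplication.Theorems.SnSubsetDichotomyPolynomialSlackMarginals
import Summits.MatrixMultiplication.MatrixMultiplication.Theorems.SnSubsetDichotomyPolynomialSlackSpreadLevelOne

/-!
# The dominant hub bound: a dominant position gives the volume bound with no sharp mass

Crux `Summit.MatrixMultiplication.MatrixMultiplication.Theses.SnSubsetDichotomy.PolynomialSlack`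
(item `stmt-MatrixMultiplication-8306`), level-one programme, lead c8 (beyond the 5/8 step: hub
certification without sharp mass), line transport-split-hull. For a TPP triple `S, T, U ⊆ S_n` of
non-empty sets with quotient profiles `d_A = m_{ST}/|S||T|`, `d_B = m_{TU}/|T||U|`, `d_C = m_{US}/|U||S|`,
heavy thresholds `θ_B, θ_C ≥ 16/n`, heavy parts `p_X = (d_X - 1/n)·[d_X ≥ θ_X]`, and a position `k`
whose column/row heavy masses `σ_k = Σ_j p_B(j,k)`, `ρ_k = Σ_i p_C(k,i)` and weight
`Ψ_k = Σ_{i,j} d_A(i,j) p_B(j,k) p_C(k,i)` are DOMINANT, `1 - ε ≤ ((n-1)/n)·σ_k ρ_k - (n-1)·Ψ_k` with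
`0 < ε ≤ 1/(2000(1+log n)⁴)`:

  `|S||T||U| ≤ 9600²·9⁴·768·(1+log n)^{10}·log²(6·n!/(|S||T|))·n·ε·B`     (`volume_le_of_dominant_hub`)

for every bound `B` on the volumes of TPP triples of `S_{n-1}` — the form of the sharp hub bound
`volume_le_of_hub_sharp` (file `…HubSharp`, whose steps 0–3 and 6–10 are repeated here) with the hub
position GIVEN and no sharp-mass hypothesis. Proof: `σ_k, ρ_k ∈ [0,1]` (column sums of `d_B` and row
sums of `d_C` are `1`) and `Ψ_k ≥ 0`, so dominance gives `σ_k ρ_k ≥ 1 - ε`, hence `σ_k, ρ_k ≥ 1 - ε`,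
`σ_k + ρ_k - 1 ≥ 1 - 2ε ≥ 1/2 = 2q` (`q = 1/4`), and `(n-1)Ψ_k ≤ ε - 1/n ≤ ε`, `Ψ_k ≤ 2ε/n`; for the
heavy sets `J = {j : d_B(j,k) ≥ θ_B}`, `I = {i : d_C(k,i) ≥ θ_C}` the hub mass is
`Σ_v μ X_J Y_I ≥ Σ_v μ (X_J + Y_I - 1) ≥ σ_k + ρ_k - 1 ≥ 2q` (`sum_pairMarginal_col/row_block_eq`,
`(1-X)(1-Y) ≥ 0`), the block weight is `Σ_{I×J} d_A d_B d_C ≤ (16/15)²Ψ_k ≤ 3ε/n = η/n`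
(`d_B ≤ (16/15)p_B`, `d_C ≤ (16/15)p_C` on heavy cells), the links are `≥ 16/n ≥ 1/n²`, and
`81(1+log n)⁴η = 243(1+log n)⁴ε ≤ 243/2000 ≤ 1/8 = 2q²`; the general hub lemma `hub_volume_dyadic`
gives `|S||T||U| ≤ 9600²·9⁴·(1+log n)^{10}·L²·n·η·B/q⁴` and `η/q⁴ = 3·4⁴·ε = 768ε`.
-/

namespace Summit.MatrixMultiplication.MatrixMultiplication.Theorems.PolynomialSlack

open scoped BigOperators
open Literature.Combinatorics.Additive (TripleProductProperty)

-- `Summit.<Summit>.<Problem>` is the tree's mandated summit-side namespace (CONVENTIONS §2); for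
-- this single-conjunct summit the two coincide, so each declaration silences `dupNamespace`.
set_option linter.dupNamespace false

set_option maxHeartbeats 1600000 in
/-- **The dominant hub bound.** For `n ≥ 2`, a TPP triple `S, T, U ⊆ S_n` of non-empty sets, a bound
`B` on the volumes of TPP triples of `S_{n-1}`, quotient profiles `dA, dB, dC`, heavy thresholds
`θB, θC ≥ 16/n` with heavy parts `pB, pC`, `0 < ε ≤ 1/(2000(1+log n)⁴)`, and a position `k` that is
DOMINANT, `1 - ε ≤ ((n-1)/n)·(Σ_j pB j k)(Σ_i pC k i) - (n-1)·Σ_{i,j} dA i j · pB j k · pC k i`: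
`|S||T||U| ≤ 9600²·9⁴·768·(1+log n)^{10}·log²(6n!/(|S||T|))·n·ε·B` — no sharp-mass hypothesis.
[folklore] -/
theorem volume_le_of_dominant_hub {n : ℕ} (hn : 2 ≤ n) (B : ℕ)
    (hB : ∀ S' T' U' : Finset (Equiv.Perm (Fin (n - 1))), TripleProductProperty S' T' U' →
      S'.card * T'.card * U'.card ≤ B)
    {S T U : Finset (Equiv.Perm (Fin n))} (hTPP : TripleProductProperty S T U)
    (hS0 : S.Nonempty) (hT0 : T.Nonempty) (hU0 : U.Nonempty)
    (dA dB dC pB pC : Fin n → Fin n → ℝ)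
    (hdA : ∀ i j, dA i j = (((S ×ˢ T).filter fun st => st.2 j = st.1 i).card : ℝ) / (S.card * T.card : ℕ))
    (hdB : ∀ j k, dB j k = (((T ×ˢ U).filter fun tu => tu.2 k = tu.1 j).card : ℝ) / (T.card * U.card : ℕ))
    (hdC : ∀ k i, dC k i = (((U ×ˢ S).filter fun us => us.2 i = us.1 k).card : ℝ) / (U.card * S.card : ℕ))
    (θB θC : ℝ) (hθB : 16 / (n : ℝ) ≤ θB) (hθC : 16 / (n : ℝ) ≤ θC)
    (hpB : ∀ j k, pB j k = if θB ≤ dB j k then dB j k - 1 / n else 0)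
    (hpC : ∀ k i, pC k i = if θC ≤ dC k i then dC k i - 1 / n else 0)
    (k : Fin n) (ε : ℝ) (hε0 : 0 < ε) (hε : ε ≤ 1 / (2000 * (1 + Real.log n) ^ 4))
    (hdom : 1 - ε ≤ ((n : ℝ) - 1) / n * ((∑ j : Fin n, pB j k) * (∑ i : Fin n, pC k i)) -
      ((n : ℝ) - 1) * ∑ i : Fin n, ∑ j : Fin n, dA i j * pB j k * pC k i) :
    ((S.card * T.card * U.card : ℕ) : ℝ) ≤
      9600 ^ 2 * 9 ^ 4 * 768 * (1 + Real.log n) ^ 10 *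
        (Real.log (6 * n.factorial / (S.card * T.card : ℕ))) ^ 2 * n * ε * B := by
  classical
  /- 0. scalars -/
  have hnR : (2 : ℝ) ≤ n := by exact_mod_cast hn
  have hn0 : (0 : ℝ) < n := by linarith
  have hm0 : (0 : ℝ) < (n : ℝ) - 1 := by linarith
  have h16n : (0 : ℝ) < 16 / n := by positivity
  have hθB0 : 0 < θB := lt_of_lt_of_le h16n hθB
  have hθC0 : 0 < θC := lt_of_lt_of_le h16n hθC
  have h16 : (0 : ℝ) < 16 := by norm_num
  have hinvB : 1 / (n : ℝ) ≤ θB / 16 := by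
    rw [div_le_div_iff₀ hn0 h16]; rw [div_le_iff₀ hn0] at hθB; linarith
  have hinvC : 1 / (n : ℝ) ≤ θC / 16 := by
    rw [div_le_div_iff₀ hn0 h16]; rw [div_le_iff₀ hn0] at hθC; linarith
  have hG1 : (1 : ℝ) ≤ 1 + Real.log n := by
    linarith [Real.log_nonneg (show (1 : ℝ) ≤ n by linarith)]
  have hG0 : (0 : ℝ) < 1 + Real.log n := by linarith
  have hG4 : (1 : ℝ) ≤ (1 + Real.log n) ^ 4 := one_le_pow₀ hG1
  -- `ε ≤ 1/2000 ≤ 1/4`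
  have hε4 : ε ≤ 1 / 4 := by
    refine hε.trans ?_
    rw [div_le_div_iff₀ (by positivity) (by norm_num : (0 : ℝ) < 4)]
    linarith
  set cS : ℝ := (S.card : ℝ) with hcS
  set cT : ℝ := (T.card : ℝ) with hcT
  set cU : ℝ := (U.card : ℝ) with hcU
  have hcS0 : 0 < cS := by rw [hcS]; exact_mod_cast hS0.card_pos
  have hcT0 : 0 < cT := by rw [hcT]; exact_mod_cast hT0.card_pos
  have hcU0 : 0 < cU := by rw [hcU]; exact_mod_cast hU0.card_pos
  have hαe : ((S.card * T.card : ℕ) : ℝ) = cS * cT := by push_cast; rw [hcS, hcT]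
  have hβe : ((T.card * U.card : ℕ) : ℝ) = cT * cU := by push_cast; rw [hcT, hcU]
  have hγe : ((U.card * S.card : ℕ) : ℝ) = cU * cS := by push_cast; rw [hcU, hcS]
  have hTfil : ∀ (p : Equiv.Perm (Fin n) → Prop) [DecidablePred p], ((T.filter p).card : ℝ) ≤ cT :=
    fun p _ => by rw [hcT]; exact_mod_cast Finset.card_filter_le _ _
  have hSfil : ∀ (p : Equiv.Perm (Fin n) → Prop) [DecidablePred p], ((S.filter p).card : ℝ) ≤ cS :=
    fun p _ => by rw [hcS]; exact_mod_cast Finset.card_filter_le _ _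
  have hUcol : ∑ v : Fin n, ((U.filter fun u => u k = v).card : ℝ) = cU := by
    rw [hcU]; exact sum_marginal_col U k
  have hcUne : cU ≠ 0 := hcU0.ne'
  clear_value cS cT cU
  /- 1. the marginals and the profiles -/
  set mA : Fin n → Fin n → ℝ := fun i j => (((S ×ˢ T).filter fun st => st.2 j = st.1 i).card : ℝ) with hmA
  set mB : Fin n → Fin n → ℝ := fun j k => (((T ×ˢ U).filter fun tu => tu.2 k = tu.1 j).card : ℝ) with hmB
  set mC : Fin n → Fin n → ℝ := fun k i => (((U ×ˢ S).filter fun us => us.2 i = us.1 k).card : ℝ) with hmC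
  have hdA' : ∀ i j, dA i j = mA i j / (cS * cT) := fun i j => by rw [hdA, hαe]
  have hdB' : ∀ j k, dB j k = mB j k / (cT * cU) := fun j k => by rw [hdB, hβe]
  have hdC' : ∀ k i, dC k i = mC k i / (cU * cS) := fun k i => by rw [hdC, hγe]
  have hmA0 : ∀ i j, 0 ≤ mA i j := fun i j => by simp only [hmA]; exact Nat.cast_nonneg _
  have hmB0 : ∀ j k, 0 ≤ mB j k := fun j k => by simp only [hmB]; exact Nat.cast_nonneg _
  have hmC0 : ∀ k i, 0 ≤ mC k i := fun k i => by simp only [hmC]; exact Nat.cast_nonneg _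
  have hdA0 : ∀ i j, 0 ≤ dA i j := fun i j => (hdA' i j).symm ▸ div_nonneg (hmA0 i j) (mul_pos hcS0 hcT0).le
  have hdB0 : ∀ j k, 0 ≤ dB j k := fun j k => (hdB' j k).symm ▸ div_nonneg (hmB0 j k) (mul_pos hcT0 hcU0).le
  have hdC0 : ∀ k i, 0 ≤ dC k i := fun k i => (hdC' k i).symm ▸ div_nonneg (hmC0 k i) (mul_pos hcU0 hcS0).le
  -- column sums of `dB` and row sums of `dC` are `1`
  have hcolB : ∀ k, ∑ j : Fin n, dB j k = 1 := by
    intro k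
    have h := sum_pairMarginal_fst T U k
    have h' : ∑ j : Fin n, mB j k = cT * cU := by
      simp only [hmB, hcT, hcU]; exact_mod_cast h
    simp_rw [hdB' _ k]
    rw [← Finset.sum_div, h', div_self (mul_pos hcT0 hcU0).ne']
  have hrowC : ∀ k, ∑ i : Fin n, dC k i = 1 := by
    intro k
    have h := sum_pairMarginal_snd U S k
    have h' : ∑ i : Fin n, mC k i = cU * cS := by
      simp only [hmC, hcU, hcS]; exact_mod_cast h
    simp_rw [hdC' k]
    rw [← Finset.sum_div, h', div_self (mul_pos hcU0 hcS0).ne']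
  clear_value mA mB mC
  /- 2. the heavy parts -/
  have h1n : (0 : ℝ) ≤ 1 / n := by positivity
  have hpB0 : ∀ j k, 0 ≤ pB j k := by
    intro j k; rw [hpB]; split_ifs with h <;> linarith [hinvB, hθB0]
  have hpC0 : ∀ k i, 0 ≤ pC k i := by
    intro k i; rw [hpC]; split_ifs with h <;> linarith [hinvC, hθC0]
  have hpBle : ∀ j k, pB j k ≤ (if θB ≤ dB j k then dB j k else 0) := by
    intro j k; rw [hpB]; split_ifs with h <;> linarith
  have hpCle : ∀ k i, pC k i ≤ (if θC ≤ dC k i then dC k i else 0) := by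
    intro k i; rw [hpC]; split_ifs with h <;> linarith
  have hifB : ∀ j k, (if θB ≤ dB j k then dB j k else 0) ≤ dB j k := fun j k => by
    split_ifs <;> linarith [hdB0 j k]
  have hifC : ∀ k i, (if θC ≤ dC k i then dC k i else 0) ≤ dC k i := fun k i => by
    split_ifs <;> linarith [hdC0 k i]
  -- on heavy cells `dB ≤ (16/15) pB`, `dC ≤ (16/15) pC` (as `1/n ≤ θ/16 ≤ d/16`)
  have hdBp : ∀ j k, θB ≤ dB j k → dB j k ≤ 16 / 15 * pB j k := fun j k h => by
    rw [hpB, if_pos h]; linarith [hinvB]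
  have hdCp : ∀ k i, θC ≤ dC k i → dC k i ≤ 16 / 15 * pC k i := fun k i h => by
    rw [hpC, if_pos h]; linarith [hinvC]
  /- 3. column / row heavy masses -/
  set σ : Fin n → ℝ := fun k => ∑ j : Fin n, pB j k with hσ
  set ρ : Fin n → ℝ := fun k => ∑ i : Fin n, pC k i with hρ
  have hσk : ∀ k, σ k = ∑ j : Fin n, pB j k := fun k => rfl
  have hρk : ∀ k, ρ k = ∑ i : Fin n, pC k i := fun k => rfl
  clear_value σ ρ
  have hσ0 : ∀ k, 0 ≤ σ k := fun k => by rw [hσk]; exact Finset.sum_nonneg fun j _ => hpB0 j k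
  have hρ0 : ∀ k, 0 ≤ ρ k := fun k => by rw [hρk]; exact Finset.sum_nonneg fun i _ => hpC0 k i
  have hσ1 : ∀ k, σ k ≤ 1 := fun k => by
    rw [hσk, ← hcolB k]; exact Finset.sum_le_sum fun j _ => (hpBle j k).trans (hifB j k)
  have hρ1 : ∀ k, ρ k ≤ 1 := fun k => by
    rw [hρk, ← hrowC k]; exact Finset.sum_le_sum fun i _ => (hpCle k i).trans (hifC k i)
  /- 4. the dominant position: `σ_k ρ_k ≥ 1 - ε`, so `σ_k + ρ_k - 1 ≥ 1 - 2ε ≥ 2q` (`q = 1/4`), and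
    `(n-1)Ψ_k ≤ ε`, `Ψ_k ≤ 2ε/n` -/
  set Ψ : ℝ := ∑ i : Fin n, ∑ j : Fin n, dA i j * pB j k * pC k i with hΨ
  have hΨ0 : 0 ≤ Ψ := Finset.sum_nonneg fun i _ => Finset.sum_nonneg fun j _ =>
    mul_nonneg (mul_nonneg (hdA0 i j) (hpB0 j k)) (hpC0 k i)
  have hdom' : 1 - ε ≤ ((n : ℝ) - 1) / n * (σ k * ρ k) - ((n : ℝ) - 1) * Ψ := by
    rw [hσk, hρk]; exact hdom
  have hσρ0 : 0 ≤ σ k * ρ k := mul_nonneg (hσ0 k) (hρ0 k)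
  have hσρ1 : σ k * ρ k ≤ 1 := mul_le_one₀ (hσ1 k) (hρ0 k) (hρ1 k)
  have hfrac0 : 0 ≤ ((n : ℝ) - 1) / n := div_nonneg hm0.le hn0.le
  have hfrac1 : ((n : ℝ) - 1) / n ≤ 1 := by rw [div_le_one hn0]; linarith
  have hfrac : ((n : ℝ) - 1) / n * (σ k * ρ k) ≤ σ k * ρ k := mul_le_of_le_one_left hσρ0 hfrac1
  have hfrac' : ((n : ℝ) - 1) / n * (σ k * ρ k) ≤ ((n : ℝ) - 1) / n :=
    mul_le_of_le_one_right hfrac0 hσρ1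
  have hmΨ : 0 ≤ ((n : ℝ) - 1) * Ψ := mul_nonneg hm0.le hΨ0
  have hmass : 1 - ε ≤ σ k * ρ k := by linarith
  have hσε : 1 - ε ≤ σ k := hmass.trans (mul_le_of_le_one_right (hσ0 k) (hρ1 k))
  have hρε : 1 - ε ≤ ρ k := hmass.trans (mul_le_of_le_one_left (hρ0 k) (hσ1 k))
  have hk : 2 * (1 / 4 : ℝ) ≤ σ k + ρ k - 1 := by linarith
  have hΨε : ((n : ℝ) - 1) * Ψ ≤ ε := by linarith
  have hΨn : Ψ ≤ 2 * ε / n := by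
    rw [le_div_iff₀ hn0]
    nlinarith [mul_nonneg hΨ0 (sub_nonneg.2 hnR)]
  /- 5. the heavy sets at the position `k` -/
  set J : Finset (Fin n) := Finset.univ.filter fun j => θB ≤ dB j k with hJ
  set I : Finset (Fin n) := Finset.univ.filter fun i => θC ≤ dC k i with hI
  have hmemJ : ∀ j ∈ J, θB ≤ dB j k := fun j hj => (Finset.mem_filter.1 hj).2
  have hmemI : ∀ i ∈ I, θC ≤ dC k i := fun i hi => (Finset.mem_filter.1 hi).2
  have hsumJ : ∑ j ∈ J, dB j k = ∑ j : Fin n, (if θB ≤ dB j k then dB j k else 0) := by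
    rw [hJ, Finset.sum_filter]
  have hsumI : ∑ i ∈ I, dC k i = ∑ i : Fin n, (if θC ≤ dC k i then dC k i else 0) := by
    rw [hI, Finset.sum_filter]
  clear_value J I
  -- link floors: `dB j k, dC k i ≥ 16/n ≥ 1/n²` on the heavy sets
  have hn2inv : 1 / (n : ℝ) ^ 2 ≤ 16 / n := by
    rw [div_le_div_iff₀ (by positivity) hn0]; nlinarith
  have hJ' : ∀ j ∈ J, 1 / (n : ℝ) ^ 2 ≤ dB j k := fun j hj => hn2inv.trans (hθB.trans (hmemJ j hj))
  have hI' : ∀ i ∈ I, 1 / (n : ℝ) ^ 2 ≤ dC k i := fun i hi => hn2inv.trans (hθC.trans (hmemI i hi))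
  /- 6. the three laws at the hub -/
  set μ : Fin n → ℝ := fun v => ((U.filter fun u => u k = v).card : ℝ) / cU with hμ
  set X : Fin n → ℝ := fun v => ((T.filter fun t => t⁻¹ v ∈ J).card : ℝ) / cT with hX
  set Y : Fin n → ℝ := fun v => ((S.filter fun s => s⁻¹ v ∈ I).card : ℝ) / cS with hY
  have hμ0 : ∀ v, 0 ≤ μ v := fun v => by rw [hμ]; exact div_nonneg (Nat.cast_nonneg _) hcU0.le
  have hX1 : ∀ v, X v ≤ 1 := fun v => by
    rw [hX]; dsimp only; rw [div_le_one hcT0]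
    exact hTfil _
  have hY1 : ∀ v, Y v ≤ 1 := fun v => by
    rw [hY]; dsimp only; rw [div_le_one hcS0]
    exact hSfil _
  have hμ1 : ∑ v : Fin n, μ v = 1 := by
    rw [hμ]; dsimp only
    rw [← Finset.sum_div, hUcol, div_self hcUne]
  clear_value μ X Y
  -- scalar identities (kept free of the big definitions)
  have key2U : ∀ a b : ℝ, a / cU * (b / cT) = a * b / (cT * cU) := by
    intro a b; rw [div_mul_div_comm, mul_comm cU cT]
  have key2S : ∀ a b : ℝ, a / cU * (b / cS) = a * b / (cU * cS) := by
    intro a b; rw [div_mul_div_comm]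
  -- `Σ_v μ X = Σ_{j ∈ J} dB j k ≥ σ k`
  have hμX : σ k ≤ ∑ v : Fin n, μ v * X v := by
    have hcol := sum_pairMarginal_col_block_eq T U J k
    have hcolR : ∑ j ∈ J, mB j k = ∑ v : Fin n,
        ((U.filter fun u => u k = v).card : ℝ) * ((T.filter fun t => t⁻¹ v ∈ J).card : ℝ) := by
      simp only [hmB]; exact_mod_cast hcol
    have e1 : ∑ v : Fin n, μ v * X v = (∑ j ∈ J, mB j k) / (cT * cU) := by
      rw [hcolR, Finset.sum_div]
      refine Finset.sum_congr rfl fun v _ => ?_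
      rw [hμ, hX]; dsimp only
      rw [key2U]
    have e2 : (∑ j ∈ J, mB j k) / (cT * cU) = ∑ j ∈ J, dB j k := by
      rw [Finset.sum_div]
      exact Finset.sum_congr rfl fun j _ => (hdB' j k).symm
    rw [e1, e2]
    calc σ k = ∑ j : Fin n, pB j k := hσk k
      _ ≤ ∑ j : Fin n, (if θB ≤ dB j k then dB j k else 0) := Finset.sum_le_sum fun j _ => hpBle j k
      _ = ∑ j ∈ J, dB j k := hsumJ.symm
  -- `Σ_v μ Y = Σ_{i ∈ I} dC k i ≥ ρ k`
  have hμY : ρ k ≤ ∑ v : Fin n, μ v * Y v := by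
    have hrow := sum_pairMarginal_row_block_eq U S I k
    have hrowR : ∑ i ∈ I, mC k i = ∑ v : Fin n,
        ((U.filter fun u => u k = v).card : ℝ) * ((S.filter fun s => s⁻¹ v ∈ I).card : ℝ) := by
      simp only [hmC]; exact_mod_cast hrow
    have e1 : ∑ v : Fin n, μ v * Y v = (∑ i ∈ I, mC k i) / (cU * cS) := by
      rw [hrowR, Finset.sum_div]
      refine Finset.sum_congr rfl fun v _ => ?_
      rw [hμ, hY]; dsimp only
      rw [key2S]
    have e2 : (∑ i ∈ I, mC k i) / (cU * cS) = ∑ i ∈ I, dC k i := by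
      rw [Finset.sum_div]
      exact Finset.sum_congr rfl fun i _ => (hdC' k i).symm
    rw [e1, e2]
    calc ρ k = ∑ i : Fin n, pC k i := hρk k
      _ ≤ ∑ i : Fin n, (if θC ≤ dC k i then dC k i else 0) := Finset.sum_le_sum fun i _ => hpCle k i
      _ = ∑ i ∈ I, dC k i := hsumI.symm
  /- 7. the hub mass: `Σ_v μ X Y ≥ Σ_v μ (X + Y - 1) ≥ σ_k + ρ_k - 1 ≥ 1/2 = 2q` -/
  have hXY : ∀ v, μ v * (X v + Y v - 1) ≤ μ v * (X v * Y v) := fun v =>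
    mul_le_mul_of_nonneg_left
      (by nlinarith [mul_nonneg (sub_nonneg.2 (hX1 v)) (sub_nonneg.2 (hY1 v))]) (hμ0 v)
  have hlowμ : 2 * (1 / 4 : ℝ) ≤ ∑ v : Fin n, μ v * (X v * Y v) := by
    calc 2 * (1 / 4 : ℝ) ≤ σ k + ρ k - 1 := hk
      _ ≤ ∑ v : Fin n, μ v * X v + ∑ v : Fin n, μ v * Y v - ∑ v : Fin n, μ v := by
          rw [hμ1]; linarith [hμX, hμY]
      _ = ∑ v : Fin n, μ v * (X v + Y v - 1) := by
          rw [← Finset.sum_add_distrib, ← Finset.sum_sub_distrib]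
          exact Finset.sum_congr rfl fun v _ => by ring
      _ ≤ ∑ v : Fin n, μ v * (X v * Y v) := Finset.sum_le_sum fun v _ => hXY v
  have hlow : 2 * (1 / 4 : ℝ) ≤ ∑ v : Fin n, ((U.filter fun u => u k = v).card : ℝ) / U.card *
      ((((T.filter fun t => t⁻¹ v ∈ J).card : ℝ) / T.card) *
        (((S.filter fun s => s⁻¹ v ∈ I).card : ℝ) / S.card)) := by
    simp only [hμ, hX, hY] at hlowμ
    rw [hcS, hcT, hcU] at hlowμ
    exact hlowμ
  /- 8. the block weight: `Σ_{I×J} dA dB dC ≤ (16/15)² Σ_{I×J} dA pB pC ≤ (16/15)² Ψ_k ≤ 3ε/n` -/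
  have hΨ' : ∑ i ∈ I, ∑ j ∈ J, dA i j * dB j k * dC k i ≤ 3 * ε / n := by
    have e1 : ∑ i ∈ I, ∑ j ∈ J, dA i j * dB j k * dC k i ≤
        256 / 225 * ∑ i ∈ I, ∑ j ∈ J, dA i j * pB j k * pC k i := by
      rw [Finset.mul_sum]
      refine Finset.sum_le_sum fun i hi => ?_
      rw [Finset.mul_sum]
      refine Finset.sum_le_sum fun j hj => ?_
      have hj' := hdBp j k (hmemJ j hj)
      have hi' := hdCp k i (hmemI i hi)
      have h1615 : (0 : ℝ) ≤ 16 / 15 := by norm_num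
      calc dA i j * dB j k * dC k i ≤ dA i j * (16 / 15 * pB j k) * (16 / 15 * pC k i) :=
            mul_le_mul (mul_le_mul_of_nonneg_left hj' (hdA0 i j)) hi' (hdC0 k i)
              (mul_nonneg (hdA0 i j) (mul_nonneg h1615 (hpB0 j k)))
        _ = 256 / 225 * (dA i j * pB j k * pC k i) := by ring
    have e2 : ∑ i ∈ I, ∑ j ∈ J, dA i j * pB j k * pC k i ≤ Ψ := by
      calc ∑ i ∈ I, ∑ j ∈ J, dA i j * pB j k * pC k i
          ≤ ∑ i : Fin n, ∑ j ∈ J, dA i j * pB j k * pC k i :=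
            Finset.sum_le_sum_of_subset_of_nonneg (Finset.subset_univ I) fun i _ _ =>
              Finset.sum_nonneg fun j _ => mul_nonneg (mul_nonneg (hdA0 i j) (hpB0 j k)) (hpC0 k i)
        _ ≤ ∑ i : Fin n, ∑ j : Fin n, dA i j * pB j k * pC k i :=
            Finset.sum_le_sum fun i _ => Finset.sum_le_sum_of_subset_of_nonneg
              (Finset.subset_univ J) fun j _ _ =>
                mul_nonneg (mul_nonneg (hdA0 i j) (hpB0 j k)) (hpC0 k i)
        _ = Ψ := hΨ.symm
    calc ∑ i ∈ I, ∑ j ∈ J, dA i j * dB j k * dC k i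
        ≤ 256 / 225 * ∑ i ∈ I, ∑ j ∈ J, dA i j * pB j k * pC k i := e1
      _ ≤ 256 / 225 * Ψ := mul_le_mul_of_nonneg_left e2 (by norm_num)
      _ ≤ 256 / 225 * (2 * ε / n) := mul_le_mul_of_nonneg_left hΨn (by norm_num)
      _ = (512 / 225 * ε) / n := by ring
      _ ≤ 3 * ε / n := div_le_div_of_nonneg_right (by nlinarith) hn0.le
  /- 9. `81(1+log n)⁴ η ≤ 2q²`: `243(1+log n)⁴ε ≤ 243/2000 ≤ 1/8` -/
  have hηq : 81 * (1 + Real.log n) ^ 4 * (3 * ε) ≤ 2 * (1 / 4 : ℝ) ^ 2 := by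
    have hG4' : (0 : ℝ) ≤ (1 + Real.log n) ^ 4 := by positivity
    have hGne : (1 + Real.log n) ≠ 0 := hG0.ne'
    have h1 : (1 + Real.log n) ^ 4 * ε ≤ 1 / 2000 := by
      calc (1 + Real.log n) ^ 4 * ε
          ≤ (1 + Real.log n) ^ 4 * (1 / (2000 * (1 + Real.log n) ^ 4)) :=
            mul_le_mul_of_nonneg_left hε hG4'
        _ = 1 / 2000 := by field_simp
    calc 81 * (1 + Real.log n) ^ 4 * (3 * ε) = 243 * ((1 + Real.log n) ^ 4 * ε) := by ring
      _ ≤ 243 * (1 / 2000) := by linarith [h1]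
      _ ≤ 2 * (1 / 4 : ℝ) ^ 2 := by norm_num
  /- 10. the general hub lemma and the arithmetic `η/q⁴ = 3·4⁴·ε = 768ε` -/
  have hmain := hub_volume_dyadic hn B hB hTPP hS0 hT0 hU0 dA dB dC hdA hdB hdC k J I (1 / 4)
    (3 * ε) (by norm_num) (by linarith) hJ' hI' hlow hΨ' hηq
  refine hmain.trans (le_of_eq ?_)
  ring

end Summit.MatrixMultiplication.MatrixMultiplication.Theorems.PolynomialSlack
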